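import Summits.QuantumFields.YangMills.Theorems.CurvatureKernelBound.Negative.Handles

/-!
# `CurvatureKernelBound` — negative lemmas, `ℓ¹` witness I: the profile `k₁` and the kernel `K = k₁(‖·‖₁)`

Supports crux item `stmt-QuantumFields-11687` (`PencilRigidity.CurvatureKernelBound`). Standing disprover's negative
lemmas (refuter, cdisprove cycle 3), ORDER-INSUFFICIENCY WITH REGULARITY chain `L1Kernel → L1Flat → L1Extension →
L1Package → L1RPKernel → L1RP → L1Main`, culminating in `L1Witness.not_axialGrowthOfTwoPointPackage`: the two-point
shadow of `W₁ ∖ lattice` plus a representing kernel continuous off `0` do NOT imply the axial growth bound of Stub E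
(`AxialGrowth`) of line `sixteen-charts-analytic-kernel`. No conclusion below asserts a Theses statement positively.

The radial profile `k₁(r) = ∫_{λ>1} λ⁹ e^{-λr} dλ` (`kfun`): non-negative, continuous on `(0,∞)`, strongly
measurable, `k₁(r) ≤ 9!/r¹⁰` (full Euler integral, `Γ(10) = 9!`), `e⁻²/r¹⁰ ≤ k₁(r)` for `r ≤ 1` (window
`λ ∈ (1/r, 2/r]`), `k₁(r) ≤ e^{1−r} k₁(1)` for `r ≥ 1`; the `ℓ¹` norm `l1` on `ℝ⁴` (`‖x‖ ≤ ‖x‖₁`); the kernel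
`Kw = kfun ∘ l1`: continuous off `0`, measurable, even, `≤ 9!‖x‖⁻¹⁰`, `≤ e^{1−‖x‖}k₁(1)`, and of ORDER EXACTLY TEN on
the axis (`Kw_axis_ge : e⁻² s⁻¹⁰ ≤ K(s e₀)`, `0 < s ≤ 1`) — the forbidden `η = 0` of the crux. [folklore]
-/

open scoped BigOperators Topology SchwartzMap
open MeasureTheory Filter Set Real
open Literature.MathematicalPhysics.QuantumLattice Literature.MathematicalPhysics.AQFT

noncomputable section

namespace Summit.QuantumFields.YangMills.Theorems.CurvatureKernelBound.Negative

namespace L1Witness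

/-! ### The radial profile -/

/-- The Euler-type integrand `λ⁹ e^{-rλ}`. -/
def kint (r t : ℝ) : ℝ := t ^ (9 : ℕ) * exp (-(r * t))

/-- The radial profile `k₁(r) = ∫_{λ>1} λ⁹ e^{-λ r} dλ` (a Laplace transform of the positive
measure `1_{λ>1} λ⁹ dλ`: completely monotone, `≍ 9!/r¹⁰` at `0⁺`, `≲ e^{-r}` at infinity). -/
def kfun (r : ℝ) : ℝ := ∫ t in Ioi (1 : ℝ), kint r t

/-- Auxiliary fact `kint_nonneg` of the `ℓ¹`-witness construction (see the module docstring). [folklore] -/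
theorem kint_nonneg (r : ℝ) {t : ℝ} (ht : 0 ≤ t) : 0 ≤ kint r t :=
  mul_nonneg (pow_nonneg ht 9) (exp_pos _).le

/-- Auxiliary fact `kint_eq_rpow` of the `ℓ¹`-witness construction (see the module docstring). [folklore] -/
theorem kint_eq_rpow (r t : ℝ) :
    kint r t = t ^ ((10 : ℝ) - 1) * exp (-(r * t)) := by
  rw [kint, ← Real.rpow_natCast t 9]
  norm_num

/-- Auxiliary fact `continuous_kint_uncurry` of the `ℓ¹`-witness construction (see the module docstring). [folklore] -/
theorem continuous_kint_uncurry : Continuous fun p : ℝ × ℝ => kint p.1 p.2 := by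
  unfold kint; fun_prop

/-- Auxiliary fact `continuous_kint` of the `ℓ¹`-witness construction (see the module docstring). [folklore] -/
theorem continuous_kint (r : ℝ) : Continuous (kint r) := by
  unfold kint; fun_prop

/-- Integrability of the Euler integrand on `(0, ∞)` for `r > 0`. -/
theorem integrableOn_kint_Ioi_zero {r : ℝ} (hr : 0 < r) : IntegrableOn (kint r) (Ioi 0) := by
  have h : IntegrableOn (fun t : ℝ => t ^ ((10 : ℝ) - 1) * exp (-(r * t))) (Ioi 0) := by
    refine Integrable.of_integral_ne_zero ?_
    rw [Real.integral_rpow_mul_exp_neg_mul_Ioi (by norm_num : (0 : ℝ) < 10) hr]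
    exact (mul_pos (by positivity) (Real.Gamma_pos_of_pos (by norm_num))).ne'
  exact h.congr_fun (fun t _ => (kint_eq_rpow r t).symm) measurableSet_Ioi

/-- Auxiliary fact `integrableOn_kint` of the `ℓ¹`-witness construction (see the module docstring). [folklore] -/
theorem integrableOn_kint {r : ℝ} (hr : 0 < r) : IntegrableOn (kint r) (Ioi 1) :=
  (integrableOn_kint_Ioi_zero hr).mono_set (Ioi_subset_Ioi zero_le_one)

/-- Auxiliary fact `kfun_nonneg` of the `ℓ¹`-witness construction (see the module docstring). [folklore] -/
theorem kfun_nonneg (r : ℝ) : 0 ≤ kfun r :=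
  setIntegral_nonneg measurableSet_Ioi fun _ ht => kint_nonneg r (zero_le_one.trans (le_of_lt ht))

/-- `Γ(10) = 9!`. -/
theorem Gamma_ten : Real.Gamma 10 = Nat.factorial 9 := by
  rw [show (10 : ℝ) = (9 : ℕ) + 1 by norm_num, Real.Gamma_nat_eq_factorial]

/-- Upper bound `k₁(r) ≤ 9! / r¹⁰` (the full Euler integral). -/
theorem kfun_le {r : ℝ} (hr : 0 < r) : kfun r ≤ Nat.factorial 9 * r⁻¹ ^ 10 := by
  calc kfun r ≤ ∫ t in Ioi (0 : ℝ), kint r t :=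
        setIntegral_mono_set (integrableOn_kint_Ioi_zero hr)
          (ae_restrict_of_forall_mem measurableSet_Ioi fun t ht => kint_nonneg r (le_of_lt ht))
          (Eventually.of_forall (Ioi_subset_Ioi zero_le_one))
    _ = ∫ t in Ioi (0 : ℝ), t ^ ((10 : ℝ) - 1) * exp (-(r * t)) :=
        setIntegral_congr_fun measurableSet_Ioi fun t _ => kint_eq_rpow r t
    _ = (1 / r) ^ (10 : ℝ) * Real.Gamma 10 :=
        Real.integral_rpow_mul_exp_neg_mul_Ioi (by norm_num) hr
    _ = Nat.factorial 9 * r⁻¹ ^ 10 := by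
        rw [Gamma_ten, one_div, show (10 : ℝ) = ((10 : ℕ) : ℝ) by norm_num, Real.rpow_natCast]
        ring

/-- Lower bound `e⁻² / r¹⁰ ≤ k₁(r)` for `0 < r ≤ 1` (the window `λ ∈ (1/r, 2/r]`). -/
theorem kfun_ge {r : ℝ} (hr : 0 < r) (hr1 : r ≤ 1) : exp (-2) * r⁻¹ ^ 10 ≤ kfun r := by
  have hri : 1 ≤ r⁻¹ := one_le_inv_iff₀.2 ⟨hr, hr1⟩
  have hsub : Ioc r⁻¹ (2 * r⁻¹) ⊆ Ioi (1 : ℝ) := fun t ht =>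
    mem_Ioi.2 (lt_of_le_of_lt hri (mem_Ioc.1 ht).1)
  have hconst : ∀ t ∈ Ioc r⁻¹ (2 * r⁻¹), exp (-2) * r⁻¹ ^ 9 ≤ kint r t := by
    intro t ht
    have ht1 : r⁻¹ ≤ t := ht.1.le
    have ht0 : 0 ≤ t := le_trans (by positivity) ht1
    have hrt : r * t ≤ 2 := by
      have := mul_le_mul_of_nonneg_left ht.2 hr.le
      rwa [show r * (2 * r⁻¹) = 2 by field_simp] at this
    calc exp (-2) * r⁻¹ ^ 9 = r⁻¹ ^ 9 * exp (-2) := mul_comm _ _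
      _ ≤ t ^ 9 * exp (-(r * t)) :=
          mul_le_mul (pow_le_pow_left₀ (by positivity) ht1 9) (exp_le_exp.2 (by linarith))
            (exp_pos _).le (pow_nonneg ht0 9)
  calc exp (-2) * r⁻¹ ^ 10 = (exp (-2) * r⁻¹ ^ 9) * (2 * r⁻¹ - r⁻¹) := by ring
    _ = ∫ _ in Ioc r⁻¹ (2 * r⁻¹), exp (-2) * r⁻¹ ^ 9 := by
        rw [setIntegral_const, Real.volume_real_Ioc_of_le (by linarith), smul_eq_mul]
        ring
    _ ≤ ∫ t in Ioc r⁻¹ (2 * r⁻¹), kint r t :=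
        setIntegral_mono_on (integrableOn_const (by simp [Real.volume_Ioc]))
          ((integrableOn_kint hr).mono_set hsub) measurableSet_Ioc hconst
    _ ≤ kfun r :=
        setIntegral_mono_set (integrableOn_kint hr)
          (ae_restrict_of_forall_mem measurableSet_Ioi fun t ht =>
            kint_nonneg r (zero_le_one.trans (le_of_lt ht)))
          (Eventually.of_forall hsub)

/-- Exponential bound `k₁(r) ≤ e^{1-r} k₁(1)` for `r ≥ 1`. -/
theorem kfun_le_exp {r : ℝ} (hr : 1 ≤ r) : kfun r ≤ exp (1 - r) * kfun 1 := by
  have hpt : ∀ t ∈ Ioi (1 : ℝ), kint r t ≤ exp (1 - r) * kint 1 t := by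
    intro t ht
    have ht1 : 1 ≤ t := le_of_lt ht
    unfold kint
    rw [mul_left_comm, ← Real.exp_add]
    gcongr
    nlinarith
  calc kfun r ≤ ∫ t in Ioi (1 : ℝ), exp (1 - r) * kint 1 t :=
        setIntegral_mono_on (integrableOn_kint (by linarith)) ((integrableOn_kint one_pos).const_mul _)
          measurableSet_Ioi hpt
    _ = exp (1 - r) * kfun 1 := by rw [integral_const_mul]; rfl

/-- Monotonicity in `r` of the integrand. -/
theorem kint_antitone {r r' : ℝ} (h : r ≤ r') {t : ℝ} (ht : 0 ≤ t) : kint r' t ≤ kint r t := by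
  unfold kint
  gcongr

/-- `k₁` is continuous on `(0, ∞)`. -/
theorem continuousOn_kfun : ContinuousOn kfun (Ioi 0) := by
  intro r hr
  have hr2 : 0 < r / 2 := by simpa using half_pos (mem_Ioi.1 hr)
  have hcont : ContinuousOn kfun (Ici (r / 2)) := by
    refine continuousOn_of_dominated (F := fun r' t => kint r' t) (bound := kint (r / 2))
      (μ := volume.restrict (Ioi (1 : ℝ))) (fun r' _ => (continuous_kint r').aestronglyMeasurable)
      (fun r' hr' => ae_restrict_of_forall_mem measurableSet_Ioi fun t ht => ?_)
      (integrableOn_kint hr2) (ae_of_all _ fun t => ?_)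
    · rw [Real.norm_of_nonneg (kint_nonneg _ (zero_le_one.trans (le_of_lt ht)))]
      exact kint_antitone hr' (zero_le_one.trans (le_of_lt ht))
    · exact (continuous_kint_uncurry.comp (continuous_id.prodMk continuous_const)).continuousOn
  exact (hcont.continuousAt (Ici_mem_nhds (by linarith [mem_Ioi.1 hr]))).continuousWithinAt

/-- `k₁` is strongly measurable (as a parametric integral of a continuous integrand). -/
theorem stronglyMeasurable_kfun : StronglyMeasurable kfun :=
  continuous_kint_uncurry.measurable.stronglyMeasurable.integral_prod_right'
    (ν := volume.restrict (Ioi (1 : ℝ)))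

/-- Auxiliary fact `measurable_kfun` of the `ℓ¹`-witness construction (see the module docstring). [folklore] -/
theorem measurable_kfun : Measurable kfun := stronglyMeasurable_kfun.measurable

/-! ### The `ℓ¹` norm on `ℝ⁴` and the kernel -/

/-- `‖x‖₁ = Σ_μ |x^μ|`. -/
def l1 (x : E4) : ℝ := ∑ μ, |x μ|

/-- Auxiliary fact `l1_nonneg` of the `ℓ¹`-witness construction (see the module docstring). [folklore] -/
theorem l1_nonneg (x : E4) : 0 ≤ l1 x := Finset.sum_nonneg fun _ _ => abs_nonneg _

/-- Auxiliary fact `continuous_l1` of the `ℓ¹`-witness construction (see the module docstring). [folklore] -/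
theorem continuous_l1 : Continuous l1 := by unfold l1; fun_prop

/-- Auxiliary fact `l1_neg` of the `ℓ¹`-witness construction (see the module docstring). [folklore] -/
theorem l1_neg (x : E4) : l1 (-x) = l1 x := by simp [l1]

/-- The Euclidean norm is dominated by the `ℓ¹` norm. -/
theorem norm_le_l1 (x : E4) : ‖x‖ ≤ l1 x := by
  have h2 : ‖x‖ ^ 2 ≤ l1 x ^ 2 := by
    rw [EuclideanSpace.real_norm_sq_eq, l1, sq, Finset.sum_mul_sum]
    refine Finset.sum_le_sum fun i _ => ?_
    rw [← Finset.mul_sum]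
    calc x i ^ 2 = |x i| * |x i| := by rw [sq]; exact (abs_mul_abs_self _).symm
      _ ≤ |x i| * ∑ j, |x j| :=
          mul_le_mul_of_nonneg_left (Finset.single_le_sum (fun j _ => abs_nonneg (x j))
            (Finset.mem_univ i)) (abs_nonneg _)
  exact (sq_le_sq₀ (norm_nonneg x) (l1_nonneg x)).1 h2

/-- Auxiliary fact `l1_pos` of the `ℓ¹`-witness construction (see the module docstring). [folklore] -/
theorem l1_pos {x : E4} (hx : x ≠ 0) : 0 < l1 x :=
  lt_of_lt_of_le (norm_pos_iff.2 hx) (norm_le_l1 x)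

/-- `‖s e₀‖₁ = |s|`. -/
theorem l1_single (i : Fin 4) (s : ℝ) : l1 (EuclideanSpace.single i s) = |s| := by
  simp [l1, Finset.sum_ite_eq', apply_ite]

/-- **The kernel** `K(x) = k₁(‖x‖₁)`. -/
def Kw (x : E4) : ℝ := kfun (l1 x)

/-- Auxiliary fact `Kw_nonneg` of the `ℓ¹`-witness construction (see the module docstring). [folklore] -/
theorem Kw_nonneg (x : E4) : 0 ≤ Kw x := kfun_nonneg _

/-- Auxiliary fact `measurable_Kw` of the `ℓ¹`-witness construction (see the module docstring). [folklore] -/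
theorem measurable_Kw : Measurable Kw := measurable_kfun.comp continuous_l1.measurable

/-- Auxiliary fact `continuousOn_Kw` of the `ℓ¹`-witness construction (see the module docstring). [folklore] -/
theorem continuousOn_Kw : ContinuousOn Kw {x : E4 | x ≠ 0} :=
  continuousOn_kfun.comp continuous_l1.continuousOn fun _ hx => l1_pos hx

/-- Auxiliary fact `Kw_neg` of the `ℓ¹`-witness construction (see the module docstring). [folklore] -/
theorem Kw_neg (x : E4) : Kw (-x) = Kw x := by rw [Kw, l1_neg, Kw]

/-- Polynomial bound `K(x) ≤ 9! ‖x‖⁻¹⁰` off `0`. -/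
theorem Kw_le {x : E4} (hx : x ≠ 0) : Kw x ≤ Nat.factorial 9 * ‖x‖⁻¹ ^ 10 := by
  have h1 := kfun_le (l1_pos hx)
  have h2 : (l1 x)⁻¹ ≤ ‖x‖⁻¹ := inv_anti₀ (norm_pos_iff.2 hx) (norm_le_l1 x)
  have h3 : (l1 x)⁻¹ ^ 10 ≤ ‖x‖⁻¹ ^ 10 := pow_le_pow_left₀ (inv_nonneg.2 (l1_nonneg x)) h2 10
  calc Kw x ≤ Nat.factorial 9 * (l1 x)⁻¹ ^ 10 := h1
    _ ≤ Nat.factorial 9 * ‖x‖⁻¹ ^ 10 := by gcongr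

/-- Exponential bound `K(x) ≤ e^{1-‖x‖} k₁(1)` for `‖x‖ ≥ 1`. -/
theorem Kw_le_exp {x : E4} (hx : 1 ≤ ‖x‖) : Kw x ≤ exp (1 - ‖x‖) * kfun 1 := by
  have h1 : 1 ≤ l1 x := hx.trans (norm_le_l1 x)
  calc Kw x ≤ exp (1 - l1 x) * kfun 1 := kfun_le_exp h1
    _ ≤ exp (1 - ‖x‖) * kfun 1 := by
        gcongr
        · exact kfun_nonneg 1
        · exact norm_le_l1 x

/-- **Order ten on the axis**: `e⁻² s⁻¹⁰ ≤ K(s e₀)` for `0 < s ≤ 1`. -/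
theorem Kw_axis_ge {s : ℝ} (hs : 0 < s) (hs1 : s ≤ 1) :
    exp (-2) * s⁻¹ ^ 10 ≤ Kw (EuclideanSpace.single 0 s) := by
  rw [Kw, l1_single, abs_of_pos hs]
  exact kfun_ge hs hs1

end L1Witness

end Summit.QuantumFields.YangMills.Theorems.CurvatureKernelBound.Negative
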